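import Summits.BirchSwinnertonDyer.BirchSwinnertonDyer.Theorems.SylvesterTwoHeegnerIndexUpperOffV0DescentDefect
import HarnessLib

/-!
# K7t crux `UpperOffV0HSYPlus` (item 19804), line `offv0-kolyvagin2`: the parity-free descent with
# defects SHARPENED by two-place reciprocity — `2 · p^{M₀+δ} · Sel ⊆ ℤ x`

Route `SylvesterTwoHeegnerIndex` (cell bsd-cm, rung K7t); stub (U1)
`stub_shaTwoExponentSharpOffV0B_of_kolyvaginDescent_two` of the registered VARIANT E skeleton on
stmt-BirchSwinnertonDyer-19804 asks for the SHARP 2-adic Kolyvagin exponent.  The landed parity-free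
count `DescentDefect.descent_defect'` (`…UpperOffV0DescentDefect`, p462120) gives
`2 · p^{2M₀+2δ+1} · Sel ⊆ ℤ x` — at `p = 2`, `δ = 1` the exponent `2^{2M₀+4}` of
`SylvesterTwoUpper.sha_two_primary_exponent_of_pointsM_of_reciprocityM`.  DIAGNOSIS (this file): of
the powers of `p` above Kolyvagin's `M₀` in that count, the doubling `2M₀`, one `δ` and the socle
`+1` are artefacts of the SINGLE-place duality axiom of the abstract count: Claim B there kills the
`λ`-term of `d_M(ℓℓ')` by multiplying with `p^{M₀+δ}` (Gross 1991, Prop. 10.2 / §10, as in the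
tree's `HypothesesM.claimB_indep`), which costs `M₀ + δ`, and feeds Čebotarev the three-class family
`{x, s, c(ℓ)}`, whose independence fails at `2` in the socle configuration.  McCallum's reciprocity
law (1991, §2 Prop. 2.2) is a sum over ALL places and is used with TWO possibly non-zero terms in
his §5 (proof of Prop. 5.2, PDF p. 287 of the held Durham volume); the tree's odd-`p`
`HypothesesM.claimB_indep_of_duality₂` (`Literature/…/HeegnerPointsKolyvaginPrimaryAnnihilatorProofs`)
recovers Kolyvagin's own annihilator `C = p^{M₀}` from it.  Here, for an ARBITRARY prime `p` and
duality defect `δ`: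

* `claimB_indep_sharp_defect` — **`p^{M₀+δ} s = 0` for `s ∈ Sel^{ε}` independent of `x`**, from
  the two-place duality `duality₂` (same shape as `duality`, with a second Kolyvagin place at which
  `d` may fail the Selmer condition and at which `s` VANISHES).  The Čebotarev instances are
  TWO-class families only: `{y, s}` (same sign; independent because `{x, s}` is) prescribing
  `s_λ = 0`, `ord y_λ = p^{M-M₀}`, then `{s, c(ℓ)}` prescribing `ord s_{λ'} = ord s`,
  `ord c(ℓ)_{λ'} = ord c(ℓ)` — with the socle fallback of `claimA_defect` when `ℤ s ∩ ℤ c(ℓ) ≠ 0`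
  (then Cor. 3.2 for `{c(ℓ)}` alone already forces `ord s_{λ'} = ord s`).  NO socle hypothesis, NO
  `hceb₁`, NO `indep_of_eigen₃`, NO `p ≠ 2`.
* `claimB_sharp_defect` — `p^{M₀+δ} s ∈ ℤ x` for every `s ∈ Sel^{ε}` (`exists_split`).
* `descent_sharp_defect` — **`2 · p^{M₀+δ} · Sel ⊆ ℤ x`** (Claim A `claimA_defect`, p461919's
  `p^{M₀+δ} Sel^{-ε} = 0`, is already sharp; the factor `2` is the eigen-decomposition
  `2s = (s + ετs) + (s − ετs)`).

At `p = 2`, `δ = 1`: **`2^{M₀+2} · S_{2^M}(E/K) ⊆ ℤ δ_M x₀`** in place of `2^{2M₀+4}` — granted the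
two-place reciprocity, which rests on Poitou–Tate exactly like the one-place (R)_M of stub (e)
(`…UpperOffV0ReciprocityTwoOfPoitouTate`; the finset form is the tree's
`X11b.KolyvaginReciprocity.kolyvaginReciprocityFinset_of_poitouTate`).  The remaining `+2` above
Kolyvagin's `M₀` is `δ = 1` (McCallum's Lemma 5.3 at `2`: the `τ`-eigenlines of `E[2^M]` pair to
`2·(unit)`, k7t-c2 g5 §5 / g7 ISOTROPY p494364) and the decomposition factor — both intrinsic to
`τ`-eigen Heegner classes.  HONEST FRAMING: pure algebra (displayed hypotheses, the fields of
`HypothesesM` without `hp2`, plus `duality₂`); no definition, no named fact, no `sorry`; NOT the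
crux and NOT stub (U1) (whose `2e ≤ ord₂ #Ш_an(E_p)` stays out of reach of any frame exponent, see
the seat memo K7T-UPPER-SHARP-k7t-c2-g8.md); B14 = O12 open as a class; BSD not claimed.
-/

noncomputable section

open scoped Classical

set_option autoImplicit false
set_option linter.dupNamespace false

namespace Summit.BirchSwinnertonDyer.BirchSwinnertonDyer.Theorems.SylvesterTwoUpper.DescentDefect

open Literature.NumberTheory.EllipticCurves.KolyvaginDescent

variable {V : Type*} [AddCommGroup V] {p M : ℕ}
variable {Pl : Type*} {M₀ δ : ℕ} {τ : V →+ V} {Sel : AddSubgroup V} {Loc : Pl → AddSubgroup V}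
  {Kol : ℕ → Prop} {pl : ℕ → Pl} {Dv : Pl → ℕ → Prop} {A : ℕ → AddSubgroup V} {x : V} {ε : ℤ}
  {c : ℕ → V}

/-- **Claim B♯ with defect, parity-free: `p^{M₀+δ} s = 0` for `s ∈ Sel^{ε}` with `ℤ x ∩ ℤ s = 0`,
under TWO-place duality.**  With `ord s = p^N`: Cor. 3.2 for the same-sign pair `{y, s}`
(independent since `{x, s}` is, `y = p^{M₀} x`) gives a Kolyvagin prime `ℓ` with `s_λ = 0` and
`ord y_λ = p^{M-M₀}`, whence `ord d_M(ℓ)_λ = p^{M-M₀}` (Prop. 4.4) and `k = ord c(ℓ) ≥ p^{M-M₀}`;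
then `ℓ' ≠ ℓ` with `ord s_{λ'} = p^N` and `ord c(ℓ)_{λ'} = p^k` — by Cor. 3.2 for `{s, c(ℓ)}` when
`ℤ s ∩ ℤ c(ℓ) = 0`, and by Cor. 3.2 for `{c(ℓ)}` alone otherwise (the `p`-socles then coincide:
`p^{N-1} s = u · p^{k-1} c(ℓ)`, `u` a unit).  The class `d_M(ℓℓ') ∈ V^{ε}` is Selmer off `{λ, λ'}`
(Lemma 4.3) with `ord d_M(ℓℓ')_{λ'} = ord c(ℓ)_{λ'} = p^k` (Prop. 4.4 at `λ'`); the reciprocity sum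
for `s` against `d_M(ℓℓ')` has its `λ`-term zero (`s_λ = 0`), so two-place duality with defect
`δ` at `λ'` gives `N + k ≤ M + δ`, i.e. `N ≤ M₀ + δ`.
[cite: McCallumLMS1991, §2 Prop. 2.2, §5 Lemma 5.3 and proof of Prop. 5.2, Cor. 3.2, Prop. 4.4]
[cite: GrossLMS1991, §10 Claim 10.3] -/
theorem claimB_indep_sharp_defect (hp : p.Prime) (torsion : ∀ v : V, ((p : ℤ) ^ M) • v = 0)
    (prime_of_kol : ∀ ℓ, Kol ℓ → ℓ.Prime)
    (dv_iff : ∀ ℓ, Kol ℓ → ∀ v, Dv v ℓ ↔ v = pl ℓ)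
    (dv_mul : ∀ ℓ ℓ', Kol ℓ → Kol ℓ' → ∀ v, Dv v (ℓ * ℓ') → Dv v ℓ ∨ Dv v ℓ')
    (x_ord : ((p : ℤ) ^ (M - 1)) • x ≠ 0) (hε : ε = 1 ∨ ε = -1) (τ_x : τ x = ε • x)
    (c_one : c 1 = ((p : ℤ) ^ M₀) • x)
    (τ_c : ∀ n, KolSupp Kol n → τ (c n) = (ε * (-1) ^ n.primeFactors.card) • c n)
    (c_mem_loc : ∀ n, KolSupp Kol n → ∀ v, ¬ Dv v n → c n ∈ Loc v)
    (c_mem_loc_iff : ∀ ℓ m, Kol ℓ → KolSupp Kol (ℓ * m) → ∀ a : ℕ,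
      (((p : ℤ) ^ a) • c (ℓ * m) ∈ Loc (pl ℓ)) ↔ ((p : ℤ) ^ a) • c m ∈ A ℓ)
    (duality₂ : ∀ ℓ ℓ', Kol ℓ → Kol ℓ' → ℓ ≠ ℓ' → ∀ ν : ℤ, (ν = 1 ∨ ν = -1) → ∀ d, τ d = ν • d →
      (∀ v, v ≠ pl ℓ → v ≠ pl ℓ' → d ∈ Loc v) → ∀ s ∈ Sel, τ s = ν • s → s ∈ A ℓ' →
      ∀ a, a < M → ((p : ℤ) ^ a) • d ∉ Loc (pl ℓ) → ((p : ℤ) ^ (M - 1 - a + δ)) • s ∈ A ℓ)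
    (cebotarev : ∀ (r : ℕ) (cs : Fin r → V) (Nv : Fin r → ℕ), (∀ i, cs i ≠ 0) →
      (∀ i, Nv i ≠ 0 → ((p : ℤ) ^ (Nv i - 1)) • cs i ≠ 0) →
      (∀ i, ∃ e : ℤ, (e = 1 ∨ e = -1) ∧ τ (cs i) = e • cs i) →
      (∀ a : Fin r → ℤ, ∑ i, a i • cs i = 0 → ∀ i, a i • cs i = 0) →
      ∀ b : ℕ, ∃ ℓ, b < ℓ ∧ Kol ℓ ∧ ∀ i, ((p : ℤ) ^ Nv i) • cs i ∈ A ℓ ∧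
        (Nv i ≠ 0 → ((p : ℤ) ^ (Nv i - 1)) • cs i ∉ A ℓ))
    {s : V} (hs : s ∈ Sel) (hτs : τ s = ε • s)
    (hind : ∀ a₀ a₁ : ℤ, a₀ • x + a₁ • s = 0 → a₁ • s = 0) :
    ((p : ℤ) ^ (M₀ + δ)) • s = 0 := by
  rcases Nat.lt_or_ge M₀ M with hM₀ | hM₀
  swap
  · exact pow_zsmul_eq_zero_of_le (by omega) (torsion s)
  obtain ⟨N, hNM, hN, hNmin⟩ := exists_exact_exponent torsion s
  by_cases hN0 : N = 0
  · subst hN0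
    rw [pow_zero, one_zsmul] at hN
    rw [hN, smul_zero]
  have hsne : s ≠ 0 := fun h ↦ hNmin (N - 1) (by omega) (by rw [h, smul_zero])
  have hsN1 : ((p : ℤ) ^ (N - 1)) • s ≠ 0 := hNmin (N - 1) (by omega)
  -- `y = p^{M₀} x`, of exact order `p^{M - M₀}`, in the `ε`-eigenspace
  set y : V := ((p : ℤ) ^ M₀) • x with hy
  obtain ⟨hy0, hy1⟩ := y_exact (M₀ := M₀) torsion x_ord hM₀
  have hyne : y ≠ 0 := fun h ↦ hy1 (by rw [← hy, h, smul_zero])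
  have hτy : τ y = ε • y := τ_y τ_x
  -- Step A: a Kolyvagin prime `ℓ₁` with `s_{λ₁} = 0` and `ord y_{λ₁} = ord y` ({y, s} independent)
  obtain ⟨ℓ₁, -, hℓ₁, hloc₁⟩ := cebotarev 2 ![y, s] ![M - M₀, 0]
    (fun i ↦ by
      fin_cases i
      · exact hyne
      · exact hsne)
    (fun i ↦ by
      fin_cases i
      · intro _
        exact hy1
      · intro h
        simp at h)
    (fun i ↦ by
      fin_cases i
      · exact ⟨ε, hε, hτy⟩
      · exact ⟨ε, hε, hτs⟩)
    (fun a ha i ↦ by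
      rw [Fin.sum_univ_two] at ha
      simp only [Matrix.cons_val_zero, Matrix.cons_val_one] at ha
      have h1 : a 1 • s = 0 := hind (a 0 * (p : ℤ) ^ M₀) (a 1) (by rwa [mul_zsmul])
      have h0 : a 0 • y = 0 := by rwa [h1, add_zero] at ha
      fin_cases i
      · exact h0
      · exact h1) 0
  have hyA : ((p : ℤ) ^ (M - M₀ - 1)) • y ∉ A ℓ₁ := by
    have := (hloc₁ 0).2 (by simp only [Matrix.cons_val_zero]; omega)
    simpa using this
  have hsA₁ : s ∈ A ℓ₁ := by simpa using (hloc₁ 1).1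
  -- `ord d_M(ℓ₁)_{λ₁} = ord y_{λ₁} = p^{M - M₀}`, so `k = ord c(ℓ₁) ≥ p^{M - M₀}`
  have hcL : ((p : ℤ) ^ (M - M₀ - 1)) • c ℓ₁ ∉ Loc (pl ℓ₁) := fun h ↦
    hyA ((c_mem_loc_iff_one prime_of_kol c_one c_mem_loc_iff hℓ₁ _).mp h)
  obtain ⟨k, hkM, hk, hkmin⟩ := exists_exact_exponent torsion (c ℓ₁)
  have hklo : M - M₀ ≤ k := by
    by_contra hlt
    exact hcL (by rw [pow_zsmul_eq_zero_of_le (by omega) hk]; exact zero_mem _)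
  have hk0 : k ≠ 0 := by omega
  have hk1 : ((p : ℤ) ^ (k - 1)) • c ℓ₁ ≠ 0 := hkmin (k - 1) (by omega)
  have hcne : c ℓ₁ ≠ 0 := fun h ↦ hk1 (by rw [h, smul_zero])
  have hτc : τ (c ℓ₁) = (-ε) • c ℓ₁ := τ_c_prime prime_of_kol τ_c hℓ₁
  -- Step B: `ℓ₂ > ℓ₁` with `ord s_{λ₂} = ord s` and `ord c(ℓ₁)_{λ₂} = ord c(ℓ₁)`
  obtain ⟨ℓ₂, hlt, hℓ₂, hsA₂, hcA₂⟩ : ∃ ℓ₂, ℓ₁ < ℓ₂ ∧ Kol ℓ₂ ∧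
      ((p : ℤ) ^ (N - 1)) • s ∉ A ℓ₂ ∧ ((p : ℤ) ^ (k - 1)) • c ℓ₁ ∉ A ℓ₂ := by
    by_cases hind₂ : ∀ a₀ a₁ : ℤ, a₀ • s + a₁ • c ℓ₁ = 0 → a₀ • s = 0 ∧ a₁ • c ℓ₁ = 0
    · -- independent pair: Cor. 3.2 for `{s, c(ℓ₁)}`
      obtain ⟨ℓ₂, hlt, hℓ₂, hloc₂⟩ := cebotarev 2 ![s, c ℓ₁] ![N, k]
        (fun i ↦ by
          fin_cases i
          · exact hsne
          · exact hcne)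
        (fun i ↦ by
          fin_cases i
          · intro _
            exact hsN1
          · intro _
            exact hk1)
        (fun i ↦ by
          fin_cases i
          · exact ⟨ε, hε, hτs⟩
          · exact ⟨-ε, neg_sign hε, hτc⟩)
        (fun a ha i ↦ by
          rw [Fin.sum_univ_two] at ha
          simp only [Matrix.cons_val_zero, Matrix.cons_val_one] at ha
          have := hind₂ _ _ ha
          fin_cases i
          · exact this.1
          · exact this.2) ℓ₁
      refine ⟨ℓ₂, hlt, hℓ₂, ?_, ?_⟩
      · have := (hloc₂ 0).2 (by simpa using hN0)
        simpa using this
      · have := (hloc₂ 1).2 (by simpa using hk0)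
        simpa using this
    · -- dependent pair: the `p`-socles coincide; Cor. 3.2 for `{c(ℓ₁)}` alone
      push Not at hind₂
      obtain ⟨a₀, a₁, hrel, hne⟩ := hind₂
      have ha₀ : a₀ • s ≠ 0 := by
        intro h0
        have h1 : a₁ • c ℓ₁ = 0 := by rwa [h0, zero_add] at hrel
        exact hne h0 h1
      -- `p^{N-1} s = w a₀ s = -w a₁ c(ℓ₁)` is a unit multiple of `p^{k-1} c(ℓ₁)`
      obtain ⟨w, hw⟩ := exists_socle_eq_zsmul hp torsion hN ha₀
      have ht : ((p : ℤ) ^ (N - 1)) • s = (-(w * a₁)) • c ℓ₁ := by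
        rw [hw, eq_neg_of_add_eq_zero_left hrel, smul_neg, smul_smul, neg_smul]
      have hpt : (p : ℤ) • (((p : ℤ) ^ (N - 1)) • s) = 0 := by
        rw [smul_smul, ← pow_succ', show N - 1 + 1 = N by omega, hN]
      obtain ⟨u, hu, hut⟩ := exists_unit_zsmul_socle hp hk0 hk hk1 ht hsN1 hpt
      obtain ⟨ℓ₂, hlt, hℓ₂, hloc₂⟩ := cebotarev 1 ![c ℓ₁] ![k]
        (fun i ↦ by
          fin_cases i
          exact hcne)
        (fun i ↦ by
          fin_cases i
          intro _
          exact hk1)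
        (fun i ↦ by
          fin_cases i
          exact ⟨-ε, neg_sign hε, hτc⟩)
        (fun a ha i ↦ by
          rw [Fin.sum_univ_one] at ha
          fin_cases i
          simpa using ha) ℓ₁
      have hcA₂ : ((p : ℤ) ^ (k - 1)) • c ℓ₁ ∉ A ℓ₂ := by
        have := (hloc₂ 0).2 (by simp only [Matrix.cons_val_zero]; exact hk0)
        simpa using this
      refine ⟨ℓ₂, hlt, hℓ₂, fun hmem ↦ hcA₂ ?_, hcA₂⟩
      rw [hut, unit_zsmul_mem_iff hp torsion hu] at hmem
      exact hmem
  -- Step C: `d = d_M(ℓ₂ℓ₁) ∈ V^{ε}`, Selmer off `{λ₂, λ₁}`, `ord d_{λ₂} = ord c(ℓ₁)_{λ₂} = p^k`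
  have hne : ℓ₂ ≠ ℓ₁ := hlt.ne'
  have hsupp : KolSupp Kol (ℓ₂ * ℓ₁) :=
    kolSupp_mul (prime_of_kol ℓ₂ hℓ₂) (prime_of_kol ℓ₁ hℓ₁) hne hℓ₂ hℓ₁
  set d := c (ℓ₂ * ℓ₁) with hd
  have hτd : τ d = ε • d := τ_c_mul prime_of_kol τ_c hℓ₂ hℓ₁ hne
  have hoff : ∀ v, v ≠ pl ℓ₂ → v ≠ pl ℓ₁ → d ∈ Loc v := by
    intro v hv₂ hv₁
    by_cases hdv : Dv v (ℓ₂ * ℓ₁)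
    · rcases dv_mul ℓ₂ ℓ₁ hℓ₂ hℓ₁ v hdv with h | h
      · exact absurd ((dv_iff ℓ₂ hℓ₂ v).mp h) hv₂
      · exact absurd ((dv_iff ℓ₁ hℓ₁ v).mp h) hv₁
    · exact c_mem_loc _ hsupp v hdv
  have hat : ((p : ℤ) ^ (k - 1)) • d ∉ Loc (pl ℓ₂) := fun h ↦
    hcA₂ ((c_mem_loc_iff ℓ₂ ℓ₁ hℓ₂ hsupp (k - 1)).mp h)
  -- two-place duality: the `λ₁`-term vanishes (`s_{λ₁} = 0`), so `ord s_{λ₂} ≤ p^{M - k + δ}`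
  have hdual := duality₂ ℓ₂ ℓ₁ hℓ₂ hℓ₁ hne ε hε d hτd hoff s hs hτs hsA₁ (k - 1) (by omega) hat
  rw [show M - 1 - (k - 1) + δ = M - k + δ by omega] at hdual
  have hle : N ≤ M - k + δ := exact_exponent_le_of_mem hdual (fun _ ↦ hsA₂)
  exact pow_zsmul_eq_zero_of_le (by omega) hN

/-- **Claim B♯ with defect (the `ε`-eigenspace): `p^{M₀+δ} s ∈ ℤ x` for every `s ∈ Sel^{ε}`**,
under two-place duality: split `s = k x + s'` with `s'` independent of `x` (`exists_split`,
`claimB_of_indep`) and apply `claimB_indep_sharp_defect` to `s'`.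
[cite: GrossLMS1991, §10 Claim 10.3] [cite: McCallumLMS1991, §2 Prop. 2.2, §5] -/
theorem claimB_sharp_defect (hp : p.Prime) (torsion : ∀ v : V, ((p : ℤ) ^ M) • v = 0)
    (prime_of_kol : ∀ ℓ, Kol ℓ → ℓ.Prime)
    (dv_iff : ∀ ℓ, Kol ℓ → ∀ v, Dv v ℓ ↔ v = pl ℓ)
    (dv_mul : ∀ ℓ ℓ', Kol ℓ → Kol ℓ' → ∀ v, Dv v (ℓ * ℓ') → Dv v ℓ ∨ Dv v ℓ')
    (x_mem : x ∈ Sel) (x_ord : ((p : ℤ) ^ (M - 1)) • x ≠ 0) (hε : ε = 1 ∨ ε = -1)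
    (τ_x : τ x = ε • x) (c_one : c 1 = ((p : ℤ) ^ M₀) • x)
    (τ_c : ∀ n, KolSupp Kol n → τ (c n) = (ε * (-1) ^ n.primeFactors.card) • c n)
    (c_mem_loc : ∀ n, KolSupp Kol n → ∀ v, ¬ Dv v n → c n ∈ Loc v)
    (c_mem_loc_iff : ∀ ℓ m, Kol ℓ → KolSupp Kol (ℓ * m) → ∀ a : ℕ,
      (((p : ℤ) ^ a) • c (ℓ * m) ∈ Loc (pl ℓ)) ↔ ((p : ℤ) ^ a) • c m ∈ A ℓ)
    (duality₂ : ∀ ℓ ℓ', Kol ℓ → Kol ℓ' → ℓ ≠ ℓ' → ∀ ν : ℤ, (ν = 1 ∨ ν = -1) → ∀ d, τ d = ν • d →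
      (∀ v, v ≠ pl ℓ → v ≠ pl ℓ' → d ∈ Loc v) → ∀ s ∈ Sel, τ s = ν • s → s ∈ A ℓ' →
      ∀ a, a < M → ((p : ℤ) ^ a) • d ∉ Loc (pl ℓ) → ((p : ℤ) ^ (M - 1 - a + δ)) • s ∈ A ℓ)
    (cebotarev : ∀ (r : ℕ) (cs : Fin r → V) (Nv : Fin r → ℕ), (∀ i, cs i ≠ 0) →
      (∀ i, Nv i ≠ 0 → ((p : ℤ) ^ (Nv i - 1)) • cs i ≠ 0) →
      (∀ i, ∃ e : ℤ, (e = 1 ∨ e = -1) ∧ τ (cs i) = e • cs i) →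
      (∀ a : Fin r → ℤ, ∑ i, a i • cs i = 0 → ∀ i, a i • cs i = 0) →
      ∀ b : ℕ, ∃ ℓ, b < ℓ ∧ Kol ℓ ∧ ∀ i, ((p : ℤ) ^ Nv i) • cs i ∈ A ℓ ∧
        (Nv i ≠ 0 → ((p : ℤ) ^ (Nv i - 1)) • cs i ∉ A ℓ))
    {s : V} (hs : s ∈ Sel) (hτs : τ s = ε • s) :
    ∃ a : ℤ, ((p : ℤ) ^ (M₀ + δ)) • s = a • x :=
  claimB_of_indep hp torsion x_mem x_ord τ_x
    (fun _ hs' hτs' hind ↦ claimB_indep_sharp_defect hp torsion prime_of_kol dv_iff dv_mul x_ord hε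
      τ_x c_one τ_c c_mem_loc c_mem_loc_iff duality₂ cebotarev hs' hτs' hind)
    hs hτs

/-- **Kolyvagin's annihilation modulo `p^M` without parity, with defect `δ`, SHARP:
`2 · p^{M₀+δ} · Sel ⊆ ℤ x`** — the displayed data of `DescentDefect.descent_defect'` (the fields of
the tree's `KolyvaginDescent.HypothesesM` for an ARBITRARY prime `p`, the one-place duality WITH
DEFECT `δ`) plus the two-place duality `duality₂` with the same defect; NO socle hypothesis and NO
extra Čebotarev instance.  `p^{M₀+δ}` kills `Sel^{-ε}` (`claimA_defect`), `p^{M₀+δ} Sel^{ε} ⊆ ℤ x`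
(`claimB_sharp_defect`), and `2s = (s + ετs) + (s − ετs)` (`two_mul_pow_zsmul_mem_zmultiples`).
At `p = 2`, `δ = 1` (the CM curves `y² = x³ − c` of the K7t line, where Lemma 5.3 loses exactly one
`2`, `…UpperOffV0DualityTwo`): **`2^{M₀+2} S_{2^M}(E/K) ⊆ ℤ δ_M x₀`**, two powers of `2` above
Kolyvagin's `C = 2^{M₀}` instead of the four of `descent_defect'` (`2^{2M₀+4}`); for `p` odd,
`δ = 0` it returns `p^{M₀} · Sel ⊆ ℤ x` (the tree's `HypothesesM.pow_M₀_zsmul_mem_zmultiples`)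
without `indep_of_eigen₃`. [cite: McCallumLMS1991, §1 Theorem (Kolyvagin), §2 Prop. 2.2, §§3–5]
[cite: GrossLMS1991, Thm. 1.3, §10] -/
theorem descent_sharp_defect (hp : p.Prime) (torsion : ∀ v : V, ((p : ℤ) ^ M) • v = 0)
    (τ_τ : ∀ v, τ (τ v) = v) (τ_mem : ∀ s ∈ Sel, τ s ∈ Sel)
    (prime_of_kol : ∀ ℓ, Kol ℓ → ℓ.Prime)
    (dv_iff : ∀ ℓ, Kol ℓ → ∀ v, Dv v ℓ ↔ v = pl ℓ)
    (dv_mul : ∀ ℓ ℓ', Kol ℓ → Kol ℓ' → ∀ v, Dv v (ℓ * ℓ') → Dv v ℓ ∨ Dv v ℓ')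
    (x_mem : x ∈ Sel) (x_ord : ((p : ℤ) ^ (M - 1)) • x ≠ 0) (hε : ε = 1 ∨ ε = -1)
    (τ_x : τ x = ε • x) (c_one : c 1 = ((p : ℤ) ^ M₀) • x)
    (τ_c : ∀ n, KolSupp Kol n → τ (c n) = (ε * (-1) ^ n.primeFactors.card) • c n)
    (c_mem_loc : ∀ n, KolSupp Kol n → ∀ v, ¬ Dv v n → c n ∈ Loc v)
    (c_mem_loc_iff : ∀ ℓ m, Kol ℓ → KolSupp Kol (ℓ * m) → ∀ a : ℕ,
      (((p : ℤ) ^ a) • c (ℓ * m) ∈ Loc (pl ℓ)) ↔ ((p : ℤ) ^ a) • c m ∈ A ℓ)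
    (duality : ∀ ℓ, Kol ℓ → ∀ ν : ℤ, (ν = 1 ∨ ν = -1) → ∀ d, τ d = ν • d →
      (∀ v, v ≠ pl ℓ → d ∈ Loc v) → ∀ s ∈ Sel, τ s = ν • s →
      ∀ a, a < M → ((p : ℤ) ^ a) • d ∉ Loc (pl ℓ) → ((p : ℤ) ^ (M - 1 - a + δ)) • s ∈ A ℓ)
    (duality₂ : ∀ ℓ ℓ', Kol ℓ → Kol ℓ' → ℓ ≠ ℓ' → ∀ ν : ℤ, (ν = 1 ∨ ν = -1) → ∀ d, τ d = ν • d →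
      (∀ v, v ≠ pl ℓ → v ≠ pl ℓ' → d ∈ Loc v) → ∀ s ∈ Sel, τ s = ν • s → s ∈ A ℓ' →
      ∀ a, a < M → ((p : ℤ) ^ a) • d ∉ Loc (pl ℓ) → ((p : ℤ) ^ (M - 1 - a + δ)) • s ∈ A ℓ)
    (cebotarev : ∀ (r : ℕ) (cs : Fin r → V) (Nv : Fin r → ℕ), (∀ i, cs i ≠ 0) →
      (∀ i, Nv i ≠ 0 → ((p : ℤ) ^ (Nv i - 1)) • cs i ≠ 0) →
      (∀ i, ∃ e : ℤ, (e = 1 ∨ e = -1) ∧ τ (cs i) = e • cs i) →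
      (∀ a : Fin r → ℤ, ∑ i, a i • cs i = 0 → ∀ i, a i • cs i = 0) →
      ∀ b : ℕ, ∃ ℓ, b < ℓ ∧ Kol ℓ ∧ ∀ i, ((p : ℤ) ^ Nv i) • cs i ∈ A ℓ ∧
        (Nv i ≠ 0 → ((p : ℤ) ^ (Nv i - 1)) • cs i ∉ A ℓ))
    {s : V} (hs : s ∈ Sel) :
    (2 * (p : ℤ) ^ (M₀ + δ)) • s ∈ AddSubgroup.zmultiples x :=
  two_mul_pow_zsmul_mem_zmultiples τ_τ τ_mem hε (E₁ := M₀ + δ) le_rfl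
    (fun _ hs' hτs' ↦ claimA_defect hp torsion prime_of_kol dv_iff x_ord hε τ_x c_one τ_c c_mem_loc
      c_mem_loc_iff duality cebotarev hs' hτs')
    (fun _ hs' hτs' ↦ claimB_sharp_defect hp torsion prime_of_kol dv_iff dv_mul x_mem x_ord hε τ_x
      c_one τ_c c_mem_loc c_mem_loc_iff duality₂ cebotarev hs' hτs')
    hs

end Summit.BirchSwinnertonDyer.BirchSwinnertonDyer.Theorems.SylvesterTwoUpper.DescentDefect

end
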